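import Mathlib
import HarnessLib
import Literature.AlgebraicGeometry.HyperbolicPolynomials.SpectrahedralShadow
import Literature.AlgebraicGeometry.DeterminantalHypersurfaces.HeltonVinnikov
import Literature.AlgebraicGeometry.DeterminantalHypersurfaces.HeltonVinnikovProofs
import Literature.ModelTheory.ExponentialFields.PointIdealGeneratorsProofs

/-!
# ValiantsHypothesis / PermanentalCones — `HyperbolicVPShadow`, glue of the Helton–Vinnikov layer

Route `PermanentalCones`, item `stmt-ValiantsHypothesis-8655` (crux `HyperbolicVPShadow`), line
`birth`, stub `stub_lowEff_glue` (stub G of the lead's c3 skeleton).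

The crux is reduced in the skeleton to linear pencils `P : ℝⁿ →ₗ Mat_N(ℝ)` all of whose values
have only real eigenvalues, and their closed nonnegative-spectrum cones
`{x : ∀ τ > 0, det (P x + τ·1) ≠ 0}`. This file proves the GLUE of the Helton–Vinnikov layer:
from the three neighbouring statements, taken verbatim as hypotheses —

* T: real-spectrum ternary pencils `Σ Xᵢ bᵢ` with `Σ eᵢ bᵢ = 1` have `det (Σ Xᵢ bᵢ)` a ternary
  hyperbolic form of degree `N` normalised at `e` (Lewis–Parrilo–Ramana rendering);
* L: the Lax conjecture / Helton–Vinnikov theorem (the named fact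
  `LewisParriloRamana2005_laxConjecture`, used through `symmetric_pencil_of_laxConjecture`);
* S: a symmetric determinantal identity `det (P x + τ·1) = det (L x + τ·1)`, `L` a linear pencil
  of symmetric matrices, makes the cone a size-`N` spectrahedron —

every such pencil `P` for which `V := span (1, range P)` has dimension `≤ 3` has a closed
nonnegative-spectrum cone that is a spectrahedral shadow of size `N`.

Proof: pad a basis of `V` to a frame `b₀, b₁, b₂ ∈ V` with a LINEAR coordinate map
`coord : V →ₗ ℝ³`, `Σ (coord v)ᵢ bᵢ = v` (`permanentalCones_exists_frame_of_finrank_le`); all of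
`V` has real spectrum (`a·1 + P x` shifts the spectrum of `P x` by `a`); with `e := coord 1` and
`c := coord ∘ P`, stub T gives the form `F`, `symmetric_pencil_of_laxConjecture` gives symmetric
`A₀, A₁, A₂` with `Σ eᵢAᵢ = 1` and `F(v) = det (Σ vᵢAᵢ)`, whence
`det (P x + τ·1) = F(c x + τe) = det (Σ cᵢ(x)Aᵢ + τ·1)`, and stub S concludes. All folklore
linear algebra.
-/

set_option linter.dupNamespace false

noncomputable section

namespace Summit.ValiantsHypothesis.ValiantsHypothesis.Theorems

open Matrix
open Literature.AlgebraicGeometry.HyperbolicPolynomials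
open Literature.AlgebraicGeometry.DeterminantalHypersurfaces

/-! ### Padding a basis of a subspace of dimension `≤ k` to a `k`-frame

The re-indexing of a zero-padded sum over `Fin k ⊇ Fin d` is the landed tree lemma
`Literature.ModelTheory.ExponentialFields.PointIdeal.sum_dite_lt` (reused, not restated). -/

/-- A frame of prescribed size `k` for a subspace with a basis of size `d ≤ k`: the basis padded
by zeros, together with a LINEAR coordinate map (the basis coordinates padded by zeros).
[folklore] -/
theorem permanentalCones_exists_frame_of_basis {K M : Type*} [Field K] [AddCommGroup M]
    [Module K M] (V : Submodule K M) {d k : ℕ} (bV : Module.Basis (Fin d) K V) (hdk : d ≤ k) :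
    ∃ (b : Fin k → M) (coord : V →ₗ[K] (Fin k → K)),
      (∀ i, b i ∈ V) ∧ ∀ v : V, ∑ i, coord v i • b i = (v : M) := by
  classical
  refine ⟨fun i => if h : (i : ℕ) < d then (bV ⟨i, h⟩ : M) else 0,
    { toFun := fun v i => if h : (i : ℕ) < d then bV.repr v ⟨i, h⟩ else 0
      map_add' := fun v w => by
        funext i
        simp only [Pi.add_apply]
        split_ifs with h
        · simp
        · simp
      map_smul' := fun a v => by
        funext i
        simp only [Pi.smul_apply, smul_eq_mul, RingHom.id_apply]
        split_ifs with h
        · simp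
        · simp },
    fun i => ?_, fun v => ?_⟩
  · show (if h : (i : ℕ) < d then (bV ⟨i, h⟩ : M) else 0) ∈ V
    split_ifs with h
    · exact (bV ⟨i, h⟩).2
    · exact V.zero_mem
  · show (∑ i : Fin k, (if h : (i : ℕ) < d then bV.repr v ⟨i, h⟩ else 0) •
        (if h : (i : ℕ) < d then (bV ⟨i, h⟩ : M) else 0)) = (v : M)
    have hterm : ∀ i : Fin k, ((if h : (i : ℕ) < d then bV.repr v ⟨i, h⟩ else 0) •
        (if h : (i : ℕ) < d then (bV ⟨i, h⟩ : M) else 0)) =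
        if h : (i : ℕ) < d then bV.repr v ⟨i, h⟩ • (bV ⟨i, h⟩ : M) else 0 := by
      intro i
      split_ifs <;> simp
    rw [Finset.sum_congr rfl fun i _ => hterm i,
      Literature.ModelTheory.ExponentialFields.PointIdeal.sum_dite_lt hdk
        fun j => bV.repr v j • (bV j : M)]
    have hv := congrArg V.subtype (bV.sum_repr v)
    simpa only [map_sum, map_smul, Submodule.subtype_apply] using hv

/-- A subspace of dimension `≤ k` of a finite-dimensional space has a `k`-frame `b` inside it with a
LINEAR coordinate map `coord`: `Σ (coord v)ᵢ bᵢ = v` for all `v`. [folklore] -/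
theorem permanentalCones_exists_frame_of_finrank_le {K M : Type*} [Field K] [AddCommGroup M]
    [Module K M] [FiniteDimensional K M] (V : Submodule K M) {k : ℕ}
    (hk : Module.finrank K V ≤ k) :
    ∃ (b : Fin k → M) (coord : V →ₗ[K] (Fin k → K)),
      (∀ i, b i ∈ V) ∧ ∀ v : V, ∑ i, coord v i • b i = (v : M) :=
  permanentalCones_exists_frame_of_basis V (Module.finBasisOfFinrankEq K V rfl) hk

/-! ### Real spectrum is stable under real shifts of the identity -/

/-- `(a·1 + Q) - z·1 = Q - (z - a)·1` over `ℂ` (entrywise): shifting a real matrix by `a·1`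
shifts its spectrum by `a`. [folklore] -/
theorem permanentalCones_map_smul_one_add_sub {N : ℕ} (a : ℝ) (Q : Matrix (Fin N) (Fin N) ℝ)
    (z : ℂ) :
    (a • (1 : Matrix (Fin N) (Fin N) ℝ) + Q).map (algebraMap ℝ ℂ) -
        z • (1 : Matrix (Fin N) (Fin N) ℂ) =
      Q.map (algebraMap ℝ ℂ) - (z - (a : ℂ)) • (1 : Matrix (Fin N) (Fin N) ℂ) := by
  ext i j
  simp only [Matrix.sub_apply, Matrix.map_apply, Matrix.add_apply, Matrix.smul_apply,
    Matrix.one_apply, smul_eq_mul, mul_ite, mul_one, mul_zero, Complex.coe_algebraMap]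
  split_ifs <;> push_cast <;> ring

/-! ### The glue -/

/-- **Glue of the Helton–Vinnikov layer** (stub G of the c3 skeleton of crux `HyperbolicVPShadow`):
from stubs T (real-spectrum ternary pencils are hyperbolic forms), L (the Lax conjecture, the
named fact `LewisParriloRamana2005_laxConjecture`) and S (a symmetric determinantal identity makes
the cone a spectrahedron) — all taken verbatim as hypotheses — every linear pencil `P` of real
`N × N` matrices with only real eigenvalues whose values together with the identity span a space of
dimension `≤ 3` has a closed nonnegative-spectrum cone that is a spectrahedron of size `N`.
[folklore] -/
theorem stub_lowEff_glue :
    (∀ (N : ℕ) (b : Fin 3 → Matrix (Fin N) (Fin N) ℝ) (e : Fin 3 → ℝ),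
      ∑ i, e i • b i = 1 →
      (∀ (w : Fin 3 → ℝ) (z : ℂ),
        ((∑ i, w i • b i).map (algebraMap ℝ ℂ) - z • (1 : Matrix (Fin N) (Fin N) ℂ)).det = 0 →
          z.im = 0) →
      ∃ F : MvPolynomial (Fin 3) ℝ, F.IsHomogeneous N ∧ MvPolynomial.eval e F = 1 ∧
        (∀ w : Fin 3 → ℝ, Multiset.card (MvPolynomial.aeval
          (fun i => Polynomial.C (w i) - Polynomial.C (e i) * Polynomial.X) F).roots = N) ∧
        ∀ v : Fin 3 → ℝ, MvPolynomial.eval v F = (∑ i, v i • b i).det) →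
    Literature.AlgebraicGeometry.DeterminantalHypersurfaces.LewisParriloRamana2005_laxConjecture →
    (∀ (n N : ℕ) (P L : (Fin n → ℝ) →ₗ[ℝ] Matrix (Fin N) (Fin N) ℝ),
      (∀ x : Fin n → ℝ, (L x).IsSymm) →
      (∀ (x : Fin n → ℝ) (τ : ℝ), (P x + τ • (1 : Matrix (Fin N) (Fin N) ℝ)).det =
        (L x + τ • (1 : Matrix (Fin N) (Fin N) ℝ)).det) →
      Literature.AlgebraicGeometry.HyperbolicPolynomials.IsSpectrahedralShadowOfSize
        {x : Fin n → ℝ | ∀ τ : ℝ, 0 < τ → (P x + τ • (1 : Matrix (Fin N) (Fin N) ℝ)).det ≠ 0} N) →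
    ∀ (n N : ℕ) (P : (Fin n → ℝ) →ₗ[ℝ] Matrix (Fin N) (Fin N) ℝ),
      (∀ (x : Fin n → ℝ) (z : ℂ),
        ((P x).map (algebraMap ℝ ℂ) - z • (1 : Matrix (Fin N) (Fin N) ℂ)).det = 0 → z.im = 0) →
      Module.finrank ℝ (Submodule.span ℝ
        (insert (1 : Matrix (Fin N) (Fin N) ℝ) (Set.range P))) ≤ 3 →
      Literature.AlgebraicGeometry.HyperbolicPolynomials.IsSpectrahedralShadowOfSize
        {x : Fin n → ℝ | ∀ τ : ℝ, 0 < τ → (P x + τ • (1 : Matrix (Fin N) (Fin N) ℝ)).det ≠ 0} N := by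
  intro hT hLax hS n N P hP hdim
  classical
  -- the space `V = span (1, range P)`
  set V : Submodule ℝ (Matrix (Fin N) (Fin N) ℝ) :=
    Submodule.span ℝ (insert (1 : Matrix (Fin N) (Fin N) ℝ) (Set.range P)) with hV
  have h1V : (1 : Matrix (Fin N) (Fin N) ℝ) ∈ V := Submodule.subset_span (Set.mem_insert _ _)
  have hPV : ∀ x, P x ∈ V := fun x =>
    Submodule.subset_span (Set.mem_insert_of_mem _ (Set.mem_range_self x))
  -- every element of `V` has only real eigenvalues
  have hRSV : ∀ M ∈ V, ∀ z : ℂ,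
      (M.map (algebraMap ℝ ℂ) - z • (1 : Matrix (Fin N) (Fin N) ℂ)).det = 0 → z.im = 0 := by
    intro M hM z hz
    rw [Submodule.mem_span_insert] at hM
    obtain ⟨a, Q, hQ, rfl⟩ := hM
    have hQ' : Q ∈ LinearMap.range P :=
      (Submodule.span_le.mpr (Set.range_subset_iff.mpr fun x => LinearMap.mem_range_self P x)) hQ
    obtain ⟨x, rfl⟩ := LinearMap.mem_range.1 hQ'
    rw [permanentalCones_map_smul_one_add_sub] at hz
    have him := hP x (z - (a : ℂ)) hz
    rwa [Complex.sub_im, Complex.ofReal_im, sub_zero] at him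
  -- a `3`-frame of `V` with linear coordinates
  obtain ⟨b, coord, hbV, hsum⟩ := permanentalCones_exists_frame_of_finrank_le V hdim
  set e : Fin 3 → ℝ := coord ⟨1, h1V⟩ with he
  have he1 : ∑ i, e i • b i = 1 := hsum ⟨1, h1V⟩
  set c : (Fin n → ℝ) →ₗ[ℝ] (Fin 3 → ℝ) := coord.comp (LinearMap.codRestrict V P hPV) with hc
  have hcP : ∀ x, ∑ i, c x i • b i = P x := fun x => hsum ⟨P x, hPV x⟩
  -- the frame pencil has real spectrum, so stub T applies
  have hRSb : ∀ (w : Fin 3 → ℝ) (z : ℂ),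
      ((∑ i, w i • b i).map (algebraMap ℝ ℂ) - z • (1 : Matrix (Fin N) (Fin N) ℂ)).det = 0 →
        z.im = 0 :=
    fun w z hz => hRSV _ (Submodule.sum_mem V fun i _ => Submodule.smul_mem V (w i) (hbV i)) z hz
  obtain ⟨F, hFhom, hFe, hFroots, hFeval⟩ := hT N b e he1 hRSb
  -- the Lax conjecture (general direction): a symmetric pencil normalised at `e`
  have hepos : 0 < MvPolynomial.eval e F := by
    rw [hFe]
    exact one_pos
  obtain ⟨A₀, A₁, A₂, hA₀, hA₁, hA₂, hAe, hAdet⟩ :=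
    symmetric_pencil_of_laxConjecture hLax hFhom hepos hFroots
  -- the symmetric linear pencil `L x = Σ cᵢ(x) Aᵢ`
  obtain ⟨L, hL⟩ : ∃ L : (Fin n → ℝ) →ₗ[ℝ] Matrix (Fin N) (Fin N) ℝ,
      ∀ x, L x = c x 0 • A₀ + c x 1 • A₁ + c x 2 • A₂ :=
    ⟨{ toFun := fun x => c x 0 • A₀ + c x 1 • A₁ + c x 2 • A₂
       map_add' := fun x y => by
         simp only [map_add, Pi.add_apply, add_smul]
         abel
       map_smul' := fun r x => by
         simp only [map_smul, Pi.smul_apply, smul_eq_mul, mul_smul, smul_add, RingHom.id_apply] },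
      fun x => rfl⟩
  have hLsymm : ∀ x : Fin n → ℝ, (L x).IsSymm := fun x => by
    rw [hL]
    exact ((hA₀.smul _).add (hA₁.smul _)).add (hA₂.smul _)
  have hident : ∀ (x : Fin n → ℝ) (τ : ℝ), (P x + τ • (1 : Matrix (Fin N) (Fin N) ℝ)).det =
      (L x + τ • (1 : Matrix (Fin N) (Fin N) ℝ)).det := by
    intro x τ
    have h1 : P x + τ • (1 : Matrix (Fin N) (Fin N) ℝ) = ∑ i, (c x + τ • e) i • b i := by
      rw [← hcP x, ← he1, Finset.smul_sum, ← Finset.sum_add_distrib]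
      refine Finset.sum_congr rfl fun i _ => ?_
      rw [Pi.add_apply, Pi.smul_apply, smul_eq_mul, add_smul, smul_smul]
    have h2 : L x + τ • (1 : Matrix (Fin N) (Fin N) ℝ) =
        (c x + τ • e) 0 • A₀ + (c x + τ • e) 1 • A₁ + (c x + τ • e) 2 • A₂ := by
      rw [hL, ← hAe]
      simp only [Pi.add_apply, Pi.smul_apply, smul_eq_mul]
      module
    rw [h1, h2, ← hFeval (c x + τ • e), hAdet (c x + τ • e), hFe, one_mul]
  exact hS n N P L hLsymm hident

end Summit.ValiantsHypothesis.ValiantsHypothesis.Theorems
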